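import Summits.BirchSwinnertonDyer.Rank1Residual.ManinAdditive.HurwitzBrandtTwoEisenstein
import HarnessLib

/-!
# Three more kernel certificates for `HurwitzBrandtTwoEisensteinTrivial`: `p = 37, 43, 67` (`rs = [3]`)

Summit `BirchSwinnertonDyer`, sub-problem `BirchSwinnertonDyer`, route `ManinLocalTwoThree`; width seat `bsd-line-manin23-p2`
(gen 9), `--supports` the crux C2 `ManinOddAtFour` (stmt-BirchSwinnertonDyer-22967; stub-6d context: E-imc-81
`TwoPNoTwoEisenstein` in its kernel-decidable Hurwitz–Brandt form, imc g16 / typer T-imc-15 leaf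
`…ManinAdditive.HurwitzBrandtTwoEisenstein`).  The leaf certifies `p ∈ {5, 11, 13, 19, 29, 53}`; this file adds the primes
`p ≡ ±3 (mod 8)` `37, 43, 67` with the single Brandt operator `T̄₃` (`decide +kernel`, axioms standard).  At
`p = 59, 61, 83, 101, 107, 109` the one-operator certificate `rs = [3]` did NOT close under `decide +kernel` (either a larger
`rs` is needed, as at `p = 53`, or the kernel evaluation is too long); not pursued here.

Each certificate is E-imc-81 at level `2p` GRANTED the reformulation E-imc-116 (docstring edge of the leaf, not in the
tree).  BSD is not proved by this; Manin's conjecture is not proved by this.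
-/

set_option autoImplicit false
set_option linter.dupNamespace false

open Summit.BirchSwinnertonDyer.Rank1Residual.ManinAdditive.HurwitzBrandt

namespace Summit.BirchSwinnertonDyer.BirchSwinnertonDyer.Theorems.ManinLocalTwoThree

/-- `classNumber 37 = 5`, `classNumber 43 = 5`, `classNumber 67 = 7` (sizes of the mod-2 Brandt matrices below). -/
theorem classNumber_thirtySeven_fortyThree_sixtySeven :
    classNumber 37 = 5 ∧ classNumber 43 = 5 ∧ classNumber 67 = 7 := by
  refine ⟨?_, ?_, ?_⟩ <;> decide +kernel

/-- Hurwitz–Brandt nil-space certificate at `p = 37` with `rs = [3]`. -/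
theorem hurwitzBrandtNilOnlyConstants_thirtySeven : HurwitzBrandtNilOnlyConstants 37 [3] := by
  decide +kernel

/-- Hurwitz–Brandt nil-space certificate at `p = 43` with `rs = [3]`. -/
theorem hurwitzBrandtNilOnlyConstants_fortyThree : HurwitzBrandtNilOnlyConstants 43 [3] := by
  decide +kernel

/-- Hurwitz–Brandt nil-space certificate at `p = 67` with `rs = [3]`. -/
theorem hurwitzBrandtNilOnlyConstants_sixtySeven : HurwitzBrandtNilOnlyConstants 67 [3] := by
  decide +kernel

/-- The `∃ rs` clauses of `HurwitzBrandtTwoEisensteinTrivial` at `p = 37, 43, 67`, discharged by `rs = [3]`. -/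
theorem hurwitzBrandtTwoEisensteinTrivial_thirtySeven_fortyThree_sixtySeven :
    (∃ rs : List ℕ, (∀ r ∈ rs, r.Prime ∧ r % 2 = 1 ∧ r ≠ 37) ∧ HurwitzBrandtNilOnlyConstants 37 rs) ∧
    (∃ rs : List ℕ, (∀ r ∈ rs, r.Prime ∧ r % 2 = 1 ∧ r ≠ 43) ∧ HurwitzBrandtNilOnlyConstants 43 rs) ∧
    (∃ rs : List ℕ, (∀ r ∈ rs, r.Prime ∧ r % 2 = 1 ∧ r ≠ 67) ∧ HurwitzBrandtNilOnlyConstants 67 rs) := by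
  refine ⟨⟨[3], fun r hr => ?_, hurwitzBrandtNilOnlyConstants_thirtySeven⟩,
    ⟨[3], fun r hr => ?_, hurwitzBrandtNilOnlyConstants_fortyThree⟩,
    ⟨[3], fun r hr => ?_, hurwitzBrandtNilOnlyConstants_sixtySeven⟩⟩ <;>
  · rw [List.mem_singleton] at hr
    subst hr
    exact ⟨Nat.prime_three, by decide, by decide⟩

end Summit.BirchSwinnertonDyer.BirchSwinnertonDyer.Theorems.ManinLocalTwoThree
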